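import Literature.NumberTheory.Transcendental.NesterenkoUResultantIntegral
import Literature.NumberTheory.Transcendental.NesterenkoEliminationProp413Proofs
import HarnessLib

/-!
# The `u`-resultant at the skew points of `ϰ` (towards LNM 1752 Ch. 3 Prop. 4.11 3)), I: freezing the skew blocks

`Literature/NumberTheory/Transcendental/NesterenkoUResultantSkewPoint.lean`. Toolkit for the value
estimate 3) of Proposition 4.11 (Nesterenko–Philippon (eds.), LNM 1752 (2001), Ch. 3;
[Nes10, Prop. 1.4]). The quantity `|J(ω̄)|` of the intersection cycle is read off from the values of
`ϰ_ω̄(G)` (`G = uResultant`, `ϰ` the skew substitution of Def. 4.6) at points `t` of the unit torus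
of the skew variables, i.e. from the values `G(z_t)` at the SKEW POINTS
`z_t = (S⁽¹⁾(t) ω̄, …, S⁽ˢ⁾(t) ω̄) ∈ ℂ^{s(m+1)}` (`zt`). This file provides:

* `eval_kappa_eq_aeval_zt` — `ϰ_ω̄(G)(t) = G(z_t)`; `norm_zt_le` — `|z_t| ≤ (m+1)|ω̄|` on the
  torus;
* the FREEZING homomorphism `freeze t : ℂ[S⁽¹⁾, …, S⁽ˢ⁺¹⁾] → ℂ[S]` (skew variables of the first
  `s` blocks ↦ the coordinates of `t`, last block ↦ the one remaining block) with
  `freeze t (ϰ_ω̄(F)) = ϰ¹_ω̄(F(z_t; ·))` (`freeze_kappa`: the one-block skew substitution of the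
  specialised form `F(z_t; ·)`, `F = chowForm 𝔭 (s+1)`) and `|freeze t (P)| ≤ ‖P‖₁` on the torus
  (`maxNorm_freeze_le_l1Norm`);
* hence **`|ϰ¹_ω̄(F(z_t; ·))| ≤ ‖ϰ_ω̄(F)‖₁ ≤ #supp ϰ_ω̄(F) · |𝔭(ω̄)| · |F| · |ω̄|^{(s+1) D}`**
  (`maxNorm_kappaOne_specForm_le`), the upper bound through `|𝔭(ω̄)| = iabs`;
* **`|F(z_t; ·)| ≤ #supp F · |F| · ((m+1)|ω̄|)^{s D}`** (`maxNorm_specForm_le`).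

No named facts; plumbing definitions `zt`, `freeze`, `specForm`, `kappaOne` (with bodies).

## References

* [NesterenkoPhilippon2001] LNM 1752 (2001), Ch. 3 §4, Def. 4.6 (p. 39), Prop. 4.11 3) (p. 41).
* [Nes10] Yu. V. Nesterenko, Proc. Steklov Inst. Math. 218 (1997) 294–331, §1.
-/

noncomputable section

open MvPolynomial Module

attribute [local instance] MvPolynomial.gradedAlgebra

namespace Literature.NumberTheory.Transcendental

namespace Nesterenko

variable {m : ℕ}

/-! ### Evaluation on the torus and `ℓ¹`-norms -/

/-- `|P(w)| ≤ ‖P‖₁` when `|w_p| ≤ 1`. [folklore] -/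
theorem norm_eval_le_l1Norm {ι : Type*} (P : MvPolynomial ι ℂ) {w : ι → ℂ} (hw : ∀ p, ‖w p‖ ≤ 1) :
    ‖eval w P‖ ≤ l1Norm P := by
  classical
  rw [eval_eq, l1Norm]
  refine (norm_sum_le _ _).trans (Finset.sum_le_sum fun γ _ => ?_)
  rw [norm_mul, norm_prod]
  calc ‖coeff γ P‖ * ∏ i ∈ γ.support, ‖w i ^ γ i‖ ≤ ‖coeff γ P‖ * 1 := by
        refine mul_le_mul_of_nonneg_left ?_ (norm_nonneg _)
        refine Finset.prod_le_one (fun i _ => norm_nonneg _) fun i _ => ?_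
        rw [norm_pow]
        exact pow_le_one₀ (norm_nonneg _) (hw i)
    _ = ‖coeff γ P‖ := mul_one _

/-! ### The skew points `z_t` -/

section Skew

variable {s : ℕ}

/-- The skew point `z_t = (S⁽¹⁾(t) ω̄, …, S⁽ˢ⁾(t) ω̄)`: `(z_t)_{ij} = λ_{ij}(ω̄)(t)`.
[cite: NesterenkoPhilippon2001, Ch. 3 Def. 4.6 (p. 39)] -/
def zt (ω : Fin (m + 1) → ℂ) (t : Fin s × SkewIdx m → ℂ) : Fin s × Fin (m + 1) → ℂ :=
  fun w => eval t (lam ω w.1 w.2)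

/-- **`ϰ_ω̄(G)(t) = G(z_t)`.** [cite: NesterenkoPhilippon2001, Ch. 3 Def. 4.6 (p. 39)] -/
theorem eval_kappa_eq_aeval_zt (ω : Fin (m + 1) → ℂ) (t : Fin s × SkewIdx m → ℂ) (G : RU s m) :
    eval t (kappa ω G) = aeval (zt ω t) G := by
  rw [kappa_eq_aeval_lam, ← MvPolynomial.aeval_eq_eval, ← AlgHom.restrictScalars_apply ℚ (aeval t),
    ← AlgHom.comp_apply, comp_aeval]
  rfl

/-- **`|(z_t)_{ij}| ≤ (m + 1) |ω̄|` on the closed unit polydisc.** [folklore] -/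
theorem norm_zt_le (ω : Fin (m + 1) → ℂ) {t : Fin s × SkewIdx m → ℂ} (ht : ∀ p, ‖t p‖ ≤ 1)
    (w : Fin s × Fin (m + 1)) : ‖zt ω t w‖ ≤ (m + 1) * ‖ω‖ :=
  (norm_eval_le_l1Norm _ ht).trans (l1Norm_lam_le ω w.1 w.2)

/-! ### Freezing the first `s` skew blocks -/

/-- The freezing map `ℂ[S⁽¹⁾, …, S⁽ˢ⁺¹⁾] → ℂ[S]`: the skew variables of the first `s` blocks are
evaluated at `t`, those of the last block become the variables of the one remaining block.
[folklore] -/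
def freeze (t : Fin s × SkewIdx m → ℂ) : RS (s + 1) m →ₐ[ℂ] RS 1 m :=
  aeval fun ip : Fin (s + 1) × SkewIdx m =>
    Fin.lastCases (motive := fun _ => RS 1 m) (X ((0 : Fin 1), ip.2)) (fun i => C (t (i, ip.2))) ip.1

/-- `freeze` on a variable of the first `s` blocks. [folklore] -/
theorem freeze_X_castSucc (t : Fin s × SkewIdx m → ℂ) (i : Fin s) (p : SkewIdx m) :
    freeze t (X (Fin.castSucc i, p)) = C (t (i, p)) := by
  simp [freeze]

/-- `freeze` on a variable of the last block. [folklore] -/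
theorem freeze_X_last (t : Fin s × SkewIdx m → ℂ) (p : SkewIdx m) :
    freeze t (X (Fin.last s, p)) = X ((0 : Fin 1), p) := by
  simp [freeze]

/-- `freeze` on the skew entries of the first `s` blocks. [folklore] -/
theorem freeze_skewEntry_castSucc (t : Fin s × SkewIdx m → ℂ) (i : Fin s) (j k : Fin (m + 1)) :
    freeze t (skewEntry (Fin.castSucc i) j k) = C (eval t (skewEntry i j k)) := by
  unfold skewEntry
  split_ifs <;> simp [freeze_X_castSucc]

/-- `freeze` on the skew entries of the last block. [folklore] -/
theorem freeze_skewEntry_last (t : Fin s × SkewIdx m → ℂ) (j k : Fin (m + 1)) :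
    freeze t (skewEntry (Fin.last s) j k) = skewEntry (0 : Fin 1) j k := by
  unfold skewEntry
  split_ifs <;> simp [freeze_X_last]

/-- `freeze t (λ_{ij}(ω̄)) = (z_t)_{ij}` for `i < s + 1` in the first blocks. [folklore] -/
theorem freeze_lam_castSucc (ω : Fin (m + 1) → ℂ) (t : Fin s × SkewIdx m → ℂ) (i : Fin s)
    (j : Fin (m + 1)) : freeze t (lam ω (Fin.castSucc i) j) = C (zt ω t (i, j)) := by
  unfold zt lam
  simp only [map_sum, map_mul, eval_C]
  refine Finset.sum_congr rfl fun k _ => ?_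
  rw [freeze_skewEntry_castSucc]
  simp [freeze]

/-- `freeze t (λ_{s+1,j}(ω̄)) = λ_{1j}(ω̄)` (the remaining block). [folklore] -/
theorem freeze_lam_last (ω : Fin (m + 1) → ℂ) (t : Fin s × SkewIdx m → ℂ) (j : Fin (m + 1)) :
    freeze t (lam ω (Fin.last s) j) = lam ω (0 : Fin 1) j := by
  unfold lam
  rw [map_sum]
  refine Finset.sum_congr rfl fun k _ => ?_
  rw [map_mul, freeze_skewEntry_last]
  simp [freeze]

/-- The specialised form `F(z; ·) ∈ ℂ[x₀, …, x_m]` at a complex point `z ∈ ℂ^{s(m+1)}`.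
[cite: NesterenkoPhilippon2001, Ch. 3 Prop. 4.11 (pp. 40–41)] -/
def specForm (𝔭 : Ideal (Rx m)) (s : ℕ) (z : Fin s × Fin (m + 1) → ℂ) : MvPolynomial (Fin (m + 1)) ℂ :=
  MvPolynomial.map ((aeval z : RU s m →ₐ[ℚ] ℂ) : RU s m →+* ℂ) (splitLast s m (chowForm 𝔭 (s + 1)))

/-- The one-block skew substitution `x_j ↦ λ_{1j}(ω̄)`. [cite: NesterenkoPhilippon2001, Ch. 3 Def. 4.6 (p. 39)] -/
def kappaOne (ω : Fin (m + 1) → ℂ) : MvPolynomial (Fin (m + 1)) ℂ →ₐ[ℂ] RS 1 m :=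
  aeval fun j => lam ω (0 : Fin 1) j

/-- **`freeze t (ϰ_ω̄(F)) = ϰ¹_ω̄(F(z_t; ·))`**: freezing the first `s` skew blocks of `ϰ_ω̄(F)` at `t`
is the one-block skew substitution of the form `F(z_t; ·)`.
[cite: NesterenkoPhilippon2001, Ch. 3 Def. 4.6 (p. 39), Prop. 4.11 3) (p. 41)] -/
theorem freeze_kappa (𝔭 : Ideal (Rx m)) (ω : Fin (m + 1) → ℂ) (t : Fin s × SkewIdx m → ℂ) :
    freeze t (kappa ω (chowForm 𝔭 (s + 1))) = kappaOne ω (specForm 𝔭 s (zt ω t)) := by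
  set F := chowForm 𝔭 (s + 1) with hF
  -- both sides are `ℚ`-algebra maps in `F` agreeing on the variables
  have hL : freeze t (kappa ω F) = aeval (fun w : Fin (s + 1) × Fin (m + 1) =>
      lastCombine (fun w' => C (zt ω t w')) (fun j => lam ω (0 : Fin 1) j) w) F := by
    have hfun : (fun w : Fin (s + 1) × Fin (m + 1) => (AlgHom.restrictScalars ℚ (freeze t)) (lam ω w.1 w.2)) =
        fun w => lastCombine (fun w' => C (zt ω t w')) (fun j => lam ω (0 : Fin 1) j) w := by
      funext w
      rcases w with ⟨i, j⟩
      refine Fin.lastCases ?_ (fun i => ?_) i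
      · simp only [AlgHom.restrictScalars_apply, lastCombine_last]
        exact freeze_lam_last ω t j
      · simp only [AlgHom.restrictScalars_apply, lastCombine_castSucc]
        exact freeze_lam_castSucc ω t i j
    rw [kappa_eq_aeval_lam, ← AlgHom.restrictScalars_apply ℚ (freeze t), ← AlgHom.comp_apply,
      comp_aeval, hfun]
  have hR : kappaOne ω (specForm 𝔭 s (zt ω t)) = aeval (fun w : Fin (s + 1) × Fin (m + 1) =>
      lastCombine (fun w' => C (zt ω t w')) (fun j => lam ω (0 : Fin 1) j) w) F := by
    have key : (((kappaOne ω : MvPolynomial (Fin (m + 1)) ℂ →+* RS 1 m).comp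
        (MvPolynomial.map ((aeval (zt ω t) : RU s m →ₐ[ℚ] ℂ) : RU s m →+* ℂ))).comp
          (splitLast s m : RU (s + 1) m →+* _)) =
        ((aeval (R := ℚ) (fun w : Fin (s + 1) × Fin (m + 1) =>
          lastCombine (fun w' => C (zt ω t w')) (fun j => lam ω (0 : Fin 1) j) w) :
            RU (s + 1) m →ₐ[ℚ] RS 1 m) : RU (s + 1) m →+* RS 1 m) := by
      refine MvPolynomial.ringHom_ext (fun q => ?_) (fun w => ?_)
      · simp only [RingHom.comp_apply, RingHom.coe_coe]
        rw [MvPolynomial.algHom_C, MvPolynomial.algebraMap_apply, map_C, kappaOne, aeval_C,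
          MvPolynomial.algHom_C]
        simp
      · rcases w with ⟨i, j⟩
        simp only [RingHom.comp_apply, RingHom.coe_coe]
        refine Fin.lastCases ?_ (fun i => ?_) i
        · rw [splitLast_X_last, map_X, aeval_X, lastCombine_last, kappaOne, aeval_X]
        · rw [splitLast_X_castSucc, map_C, aeval_X, lastCombine_castSucc, kappaOne, aeval_C, RingHom.coe_coe,
            aeval_X]
          rfl
    exact RingHom.congr_fun key F
  rw [hL, hR]

/-! ### Norm bounds for freezing -/

/-- `‖freeze t (monomial)‖₁ ≤ |c|` on the torus. [folklore] -/
theorem l1Norm_freeze_monomial_le {t : Fin s × SkewIdx m → ℂ} (ht : ∀ p, ‖t p‖ = 1)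
    (γ : Fin (s + 1) × SkewIdx m →₀ ℕ) (c : ℂ) : l1Norm (freeze t (monomial γ c)) ≤ ‖c‖ := by
  classical
  rw [freeze, aeval_monomial, MvPolynomial.algebraMap_eq]
  refine (l1Norm_mul_le _ _).trans ?_
  rw [l1Norm_C]
  refine mul_le_of_le_one_right (norm_nonneg _) ?_
  rw [Finsupp.prod]
  refine (l1Norm_prod_le _ _).trans (Finset.prod_le_one (fun _ _ => l1Norm_nonneg _) fun ip _ => ?_)
  refine (l1Norm_pow_le _ _).trans (pow_le_one₀ (l1Norm_nonneg _) ?_)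
  rcases ip with ⟨i, p⟩
  refine Fin.lastCases ?_ (fun i => ?_) i
  · simp only [Fin.lastCases_last]
    rw [l1Norm_X]
  · simp only [Fin.lastCases_castSucc]
    rw [l1Norm_C, ht]

/-- **`|freeze t (P)| ≤ ‖P‖₁` on the torus.** [folklore] -/
theorem maxNorm_freeze_le_l1Norm {t : Fin s × SkewIdx m → ℂ} (ht : ∀ p, ‖t p‖ = 1) (P : RS (s + 1) m) :
    maxNorm (freeze t P) ≤ l1Norm P := by
  classical
  refine (maxNorm_le_l1Norm _).trans ?_
  conv_lhs => rw [P.as_sum, map_sum]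
  refine (l1Norm_sum_le _ _).trans ?_
  rw [l1Norm]
  exact Finset.sum_le_sum fun γ _ => l1Norm_freeze_monomial_le ht γ _

/-- `ϰ_ω̄(F)` is a form of degree `(s+1) D` in the skew variables. [folklore] -/
theorem isHomogeneous_kappa_chowForm (𝔭 : Ideal (Rx m)) (ω : Fin (m + 1) → ℂ) (s : ℕ) :
    (kappa ω (chowForm 𝔭 (s + 1))).IsHomogeneous ((s + 1) * ideg 𝔭 (s + 1)) := by
  have hFhom : (chowForm 𝔭 (s + 1)).IsHomogeneous ((s + 1) * ideg 𝔭 (s + 1)) := fun γ hγ => by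
    have h := degree_eq_of_mem_support_chowForm 𝔭 (Nat.succ_pos s) (mem_support_iff.mpr hγ)
    rw [Finsupp.degree_eq_weight_one] at h
    exact h
  have hlam : ∀ v : Fin (s + 1) × Fin (m + 1), (lam ω v.1 v.2).IsHomogeneous 1 := by
    intro v
    unfold lam
    refine IsHomogeneous.sum _ _ _ fun l _ => ?_
    have h1 : (skewEntry v.1 v.2 l : RS (s + 1) m).IsHomogeneous 1 := by
      unfold skewEntry
      split_ifs
      · exact isHomogeneous_X _ _
      · exact (isHomogeneous_X _ _).neg
      · exact isHomogeneous_zero _ _ _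
    simpa using h1.mul (isHomogeneous_C _ (ω l))
  rw [kappa_eq_aeval_lam]
  have h := hFhom.aeval (fun v : Fin (s + 1) × Fin (m + 1) => lam ω v.1 v.2) hlam
  rwa [one_mul] at h

/-- **The upper bound through `|𝔭(ω̄)|`**: on the torus,
`|ϰ¹_ω̄(F(z_t; ·))| ≤ #supp ϰ_ω̄(F) · |𝔭(ω̄)| · |F| · |ω̄|^{(s+1)D}`, and
`#supp ϰ_ω̄(F) ≤ ((s+1) · #SkewIdx)^{(s+1)D}`.
[cite: NesterenkoPhilippon2001, Ch. 3 Def. 4.6 (p. 39), Prop. 4.11 3) (p. 41)] -/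
theorem maxNorm_kappaOne_specForm_le {𝔭 : Ideal (Rx m)} (hF0 : chowForm 𝔭 (s + 1) ≠ 0)
    {ω : Fin (m + 1) → ℂ} (hω : ω ≠ 0) {t : Fin s × SkewIdx m → ℂ} (ht : ∀ p, ‖t p‖ = 1) :
    maxNorm (kappaOne ω (specForm 𝔭 s (zt ω t))) ≤
      (Fintype.card (Fin (s + 1) × SkewIdx m) : ℝ) ^ ((s + 1) * ideg 𝔭 (s + 1)) *
        (iabs 𝔭 (s + 1) ω * (maxNorm (chowForm 𝔭 (s + 1)) * ‖ω‖ ^ ((s + 1) * ideg 𝔭 (s + 1)))) := by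
  set F := chowForm 𝔭 (s + 1) with hF
  rw [← freeze_kappa]
  refine (maxNorm_freeze_le_l1Norm ht _).trans ((l1Norm_le_card_mul_maxNorm _).trans ?_)
  have hcard : ((kappa ω F).support.card : ℝ) ≤
      (Fintype.card (Fin (s + 1) × SkewIdx m) : ℝ) ^ ((s + 1) * ideg 𝔭 (s + 1)) := by
    exact_mod_cast card_support_le_card_pow_of_isHomogeneous (isHomogeneous_kappa_chowForm 𝔭 ω s)
  have hmax : maxNorm (kappa ω F) ≤ iabs 𝔭 (s + 1) ω * (maxNorm F * ‖ω‖ ^ ((s + 1) * ideg 𝔭 (s + 1))) := by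
    have h0 : maxNorm F * ‖ω‖ ^ ((s + 1) * ideg 𝔭 (s + 1)) ≠ 0 :=
      mul_ne_zero (maxNorm_pos hF0).ne' (pow_ne_zero _ (norm_ne_zero_iff.mpr hω))
    rw [iabs, div_mul_cancel₀ _ h0]
  exact mul_le_mul hcard hmax (maxNorm_nonneg _) (by positivity)

/-! ### The Gelfond lower bound for the one-block skew substitution of a split form -/

/-- **Lower bound.** If `g = a ∏ᵢ ℓ_{γ⁽ⁱ⁾}` (`γ⁽ⁱ⁾ ≠ 0`), then
`|a| ∏ᵢ (‖ω̄ − γ⁽ⁱ⁾‖ |ω̄| |γ⁽ⁱ⁾|) ≤ e^{n D} |ϰ¹_ω̄(g)|`, `n = #(skew variables of one block)`: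
each factor `ℓ_{γ⁽ⁱ⁾}(S ω̄)` has a coefficient of modulus `≥ ‖ω̄ − γ⁽ⁱ⁾‖ |ω̄| |γ⁽ⁱ⁾|` ((20) of
Ch. 3), and Gelfond's inequality bounds the product of the heights by the height of the product.
[cite: NesterenkoPhilippon2001, Ch. 3 §4 (20) (p. 40), Prop. 4.11 3) (p. 41)] -/
theorem prod_projDist_mul_le_exp_mul_maxNorm_kappaOne (ω : Fin (m + 1) → ℂ) {D : ℕ} (a : ℂ)
    (γ : Fin D → Fin (m + 1) → ℂ) :
    ‖a‖ * ∏ i, (projDist ω (γ i) * (‖ω‖ * ‖γ i‖)) ≤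
      Real.exp (Fintype.card (Fin 1 × SkewIdx m) * D) *
        maxNorm (kappaOne ω (C a * ∏ i, (∑ j, C (γ i j) * X j))) := by
  classical
  set L : Fin D → RS 1 m := fun i => kappaOne ω (∑ j, C (γ i j) * X j) with hL
  have hκ : kappaOne ω (C a * ∏ i, (∑ j, C (γ i j) * X j)) = C a * ∏ i, L i := by
    rw [map_mul, map_prod, kappaOne, aeval_C, MvPolynomial.algebraMap_eq]
    rfl
  have hLge : ∀ i, projDist ω (γ i) * (‖ω‖ * ‖γ i‖) ≤ maxNorm (L i) := fun i =>
    projDist_mul_le_maxNorm_aeval_lam_linC ω (γ i)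
  have hfac : ∀ i, 0 ≤ projDist ω (γ i) * (‖ω‖ * ‖γ i‖) := fun i =>
    mul_nonneg (projDist_nonneg _ _) (mul_nonneg (norm_nonneg _) (norm_nonneg _))
  rw [hκ, maxNorm_C_mul]
  by_cases h0 : ∃ i, L i = 0
  · -- a vanishing factor: the left-hand side vanishes
    obtain ⟨i, hi⟩ := h0
    have hzero : projDist ω (γ i) * (‖ω‖ * ‖γ i‖) = 0 :=
      le_antisymm (by simpa [hi] using hLge i) (hfac i)
    rw [Finset.prod_eq_zero (Finset.mem_univ i) hzero, mul_zero]
    exact mul_nonneg (Real.exp_pos _).le (mul_nonneg (norm_nonneg _) (maxNorm_nonneg _))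
  · push Not at h0
    have hG := prod_maxNorm_le_exp_mul_maxNorm_prod Finset.univ L fun i _ => h0 i
    have hdeg : (∑ v : Fin 1 × SkewIdx m, (∑ i, degreeOf v (L i) : ℝ)) ≤
        Fintype.card (Fin 1 × SkewIdx m) * D := by
      calc (∑ v : Fin 1 × SkewIdx m, (∑ i, degreeOf v (L i) : ℝ))
          ≤ ∑ _v : Fin 1 × SkewIdx m, (D : ℝ) := Finset.sum_le_sum fun v _ => by
            calc (∑ i, degreeOf v (L i) : ℝ) ≤ ∑ _i : Fin D, (1 : ℝ) :=
                  Finset.sum_le_sum fun i _ => by exact_mod_cast degreeOf_aeval_lam_linC_le ω (γ i) v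
              _ = D := by simp
        _ = Fintype.card (Fin 1 × SkewIdx m) * D := by
            rw [Finset.sum_const, Finset.card_univ, nsmul_eq_mul]
    calc ‖a‖ * ∏ i, (projDist ω (γ i) * (‖ω‖ * ‖γ i‖)) ≤ ‖a‖ * ∏ i, maxNorm (L i) := by
          refine mul_le_mul_of_nonneg_left (Finset.prod_le_prod (fun i _ => hfac i) fun i _ => hLge i)
            (norm_nonneg _)
      _ ≤ ‖a‖ * (Real.exp (∑ v, (∑ i, degreeOf v (L i) : ℝ)) * maxNorm (∏ i, L i)) :=
          mul_le_mul_of_nonneg_left hG (norm_nonneg _)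
      _ ≤ ‖a‖ * (Real.exp (Fintype.card (Fin 1 × SkewIdx m) * D) * maxNorm (∏ i, L i)) := by
          refine mul_le_mul_of_nonneg_left ?_ (norm_nonneg _)
          exact mul_le_mul_of_nonneg_right (Real.exp_le_exp.mpr hdeg) (maxNorm_nonneg _)
      _ = _ := by ring

/-! ### The trivial bound for the specialised form -/

/-- `splitLast` on a monomial: `u^γ ↦ C(c ∏_{first groups} u^γ) · (last group)^γ`. [folklore] -/
theorem splitLast_monomial (s : ℕ) (γ : Fin (s + 1) × Fin (m + 1) →₀ ℕ) (c : ℚ) :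
    splitLast s m (monomial γ c) =
      C (C c * ∏ i : Fin s, ∏ j : Fin (m + 1), X (i, j) ^ γ (Fin.castSucc i, j)) *
        ∏ j : Fin (m + 1), X j ^ γ (Fin.last s, j) := by
  rw [splitLast, aeval_monomial, Finsupp.prod_pow, Fintype.prod_prod_type, Fin.prod_univ_castSucc]
  simp only [lastCombine_castSucc, lastCombine_last]
  rw [MvPolynomial.algebraMap_apply, MvPolynomial.algebraMap_eq, map_mul, map_prod]
  simp only [map_prod, map_pow]
  ring

/-- The degree of a monomial of the associated form in the first `s` groups is `s D`. [folklore] -/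
theorem sum_castSucc_eq_of_mem_support_chowForm (𝔭 : Ideal (Rx m)) (s : ℕ)
    {γ : Fin (s + 1) × Fin (m + 1) →₀ ℕ} (hγ : γ ∈ (chowForm 𝔭 (s + 1)).support) :
    ∑ i : Fin s, ∑ j : Fin (m + 1), γ (Fin.castSucc i, j) = s * ideg 𝔭 (s + 1) := by
  have h : ∀ i : Fin s, ∑ j : Fin (m + 1), γ (Fin.castSucc i, j) = ideg 𝔭 (s + 1) := fun i =>
    bdeg_eq_ideg_of_mem_support_chowForm 𝔭 (Nat.succ_pos s) hγ (Fin.castSucc i)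
  simp only [h, Finset.sum_const, Finset.card_univ, Fintype.card_fin, smul_eq_mul]

/-- **Trivial bound for the specialised form**: if `|z_{ij}| ≤ B` then
`|F(z; ·)| ≤ #supp F · |F| · B^{s D}`. [cite: NesterenkoPhilippon2001, Ch. 3 Prop. 4.11 (pp. 40–41)] -/
theorem maxNorm_specForm_le (𝔭 : Ideal (Rx m)) {z : Fin s × Fin (m + 1) → ℂ} {B : ℝ}
    (hz : ∀ w, ‖z w‖ ≤ B) :
    maxNorm (specForm 𝔭 s z) ≤
      (chowForm 𝔭 (s + 1)).support.card * maxNorm (chowForm 𝔭 (s + 1)) * B ^ (s * ideg 𝔭 (s + 1)) := by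
  classical
  set F := chowForm 𝔭 (s + 1) with hF
  set φ : RU s m →+* ℂ := ((aeval z : RU s m →ₐ[ℚ] ℂ) : RU s m →+* ℂ) with hφ
  refine (maxNorm_le_l1Norm _).trans ?_
  have hsum : specForm 𝔭 s z = ∑ γ ∈ F.support, MvPolynomial.map φ (splitLast s m (monomial γ (coeff γ F))) := by
    rw [specForm, ← hF, ← hφ]
    conv_lhs => rw [F.as_sum, map_sum, map_sum]
  rw [hsum]
  refine (l1Norm_sum_le _ _).trans ?_
  have hterm : ∀ γ ∈ F.support, l1Norm (MvPolynomial.map φ (splitLast s m (monomial γ (coeff γ F)))) ≤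
      maxNorm F * B ^ (s * ideg 𝔭 (s + 1)) := by
    intro γ hγ
    rw [splitLast_monomial, map_mul, map_C, map_prod]
    simp only [map_pow, map_X]
    refine (l1Norm_mul_le _ _).trans ?_
    have h2 : l1Norm (∏ j : Fin (m + 1), (X j : MvPolynomial (Fin (m + 1)) ℂ) ^ γ (Fin.last s, j)) ≤ 1 := by
      refine (l1Norm_prod_le _ _).trans (Finset.prod_le_one (fun _ _ => l1Norm_nonneg _) fun j _ => ?_)
      exact (l1Norm_pow_le _ _).trans (by rw [l1Norm_X, one_pow])
    rw [l1Norm_C]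
    refine (mul_le_mul_of_nonneg_left h2 (norm_nonneg _)).trans ?_
    rw [mul_one, hφ, map_mul, map_prod, norm_mul, norm_prod]
    simp only [map_prod, map_pow, RingHom.coe_coe, aeval_X, norm_prod, norm_pow]
    refine mul_le_mul ?_ ?_ (by positivity) (maxNorm_nonneg _)
    · have : ‖((aeval z : RU s m →ₐ[ℚ] ℂ) (C (coeff γ F)))‖ = ‖coeff γ F‖ := by
        rw [MvPolynomial.algHom_C, eq_ratCast, Complex.norm_ratCast, ← Real.norm_eq_abs, Rat.norm_cast_real]
      rw [this]
      exact norm_coeff_le_maxNorm F γ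
    · calc ∏ i : Fin s, ∏ j : Fin (m + 1), ‖z (i, j)‖ ^ γ (Fin.castSucc i, j)
          ≤ ∏ i : Fin s, ∏ j : Fin (m + 1), B ^ γ (Fin.castSucc i, j) :=
            Finset.prod_le_prod (fun i _ => by positivity) fun i _ =>
              Finset.prod_le_prod (fun j _ => by positivity) fun j _ =>
                pow_le_pow_left₀ (norm_nonneg _) (hz (i, j)) _
        _ = B ^ (s * ideg 𝔭 (s + 1)) := by
            rw [← sum_castSucc_eq_of_mem_support_chowForm 𝔭 s hγ]
            simp only [Finset.prod_pow_eq_pow_sum]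
  calc ∑ γ ∈ F.support, l1Norm (MvPolynomial.map φ (splitLast s m (monomial γ (coeff γ F))))
      ≤ ∑ _γ ∈ F.support, maxNorm F * B ^ (s * ideg 𝔭 (s + 1)) := Finset.sum_le_sum hterm
    _ = F.support.card * maxNorm F * B ^ (s * ideg 𝔭 (s + 1)) := by
        rw [Finset.sum_const, nsmul_eq_mul]
        ring

end Skew

end Nesterenko

end Literature.NumberTheory.Transcendental

end
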